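/-
Copyright (c) 2026. All rights reserved.
Released under Apache 2.0 license as described in the file LICENSE.
Authors: HodgeCM publication cell (pub-hodgecm), GR lane, seat GR-2 (`pub-hodgecm-own-hyp34`).
-/
import Literature.NumberTheory.Automorphic.UnitaryGroupArchimedean
import Literature.NumberTheory.Automorphic.UnitaryGroupSymplecticSplitLevi
import HarnessLib

/-!
# The archimedean factor of `U(J)(E ⊗ ℝ)` at a COMPLEX place of `F`: the pair of complex places `(w, c w)` of `E`

Topic `NumberTheory/Automorphic`; namespace `Literature.NumberTheory.Automorphic.UnitaryGroup` (continues
`UnitaryGroupArchimedean`, `UnitaryGroupArchRealPair`).  KERNEL ONLY: definitions with bodies and theorems; no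
`def … : Prop` record, no `axiom`, no proof hole.

Setting: `E/F` number fields, `c : E ≃ₐ[F] E` an involution (`hcc : c * c = 1`), `J ∈ M_N(E)`, and a COMPLEX place
`w` of `E`.  The conjugation `c ⊗ 1` of `E ⊗ ℝ = ℝ^{r₁} × ℂ^{r₂}` (`conjMixed`) carries the `w`-coordinate to the
`c w`-coordinate through a continuous ring homomorphism `ψ_w : ℂ → ℂ` (the tree's `conjCoord`, `= id` or `conj`).
When `c w ≠ w` — equivalently the place `v = w|_F` of `F` is COMPLEX — the pair `(w, c w)` is the set of places of `E`
over `v`, `E ⊗_F F_v = E_w × E_{cw} = ℂ × ℂ`, and at such a place the unitary group is a general linear group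
([PlatonovRapinchuk1994, §2.3, §3.2]; [MoeglinVignerasWaldspurger1987, Chap. 1 I.17–I.19]).  A CM extension has no
such place (`F` totally real); a general quadratic extension of a field with complex places does.

* §1 **the untwisted two-coordinate evaluation `evalCC w : E ⊗ ℝ →+* ℂ × ℂ`, `x ↦ (x_w, ψ_{cw}(x_{cw}))`**, for
  which `c ⊗ 1` IS the swap: `evalCC ((c ⊗ 1) x) = swap (evalCC x)` (`evalCC_conjMixed`; the point is
  `ψ_{cw} ∘ ψ_w = id`, `conjCoord_cPlaceC_conjCoord`: a continuous ring endomorphism of `ℂ` fixing `σ_w(E)` pointwise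
  is the identity because `w` is complex), and `evalCC (x ⊗ 1) = (σ_w x, σ_w (c x))` on `E` (`evalCC_mixedEmbedding`),
  in particular `= (σ_w t, σ_w t)` on `F` and `= (σ_w δ, -σ_w δ)` on an anti-invariant `δ`;
* §2 **`archAtComplexPair w : U(J)(E ⊗ ℝ) →* U(swap, J_{w,cw})(ℂ × ℂ)`** (continuous), and for `J = T ⊗_F E`:
  `J_{w,cw} = σ_w(T) ⊗ 1` (`map_evalCC_mixedEmbedding_of_map`), packaged as **`archAtComplexSplit`**;
* §3 the split quadratic coordinates of `K × K` over ANY field `K` of characteristic `0`: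
  `splitPairCoords s : (a, b) ↦ (a + b s, a - b s)`, **`isQuadraticCoordinates_splitPair`** (`δ = (s, -s)`,
  `δ² = s²`), `evalPlus = fst`, `evalMinus = snd` (the field-generic twin of `Weil1964.splitRealCoords`); hence
  (`UnitaryGroupSymplecticSplitLevi`) `g₊ = archAtComplexSplit g` read through `plusGL` is the `w`-COMPONENT
  `g_w ∈ GL_N(ℂ)` (`coe_plusGL_archAtComplexSplit`) and `g₋ = σ_w(T)⁻¹ g_w⁻ᵀ σ_w(T)`.

The symplectic/metaplectic reading of this factor (a conjugate of the Siegel Levi of `Sp_{4N}(ℝ)` after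
realification) is the business of the sequel; this file is the algebra of the factor.

## References
* [PlatonovRapinchuk1994] V. Platonov, A. Rapinchuk, *Algebraic Groups and Number Theory* (1994), §2.3, §3.2.
* [MoeglinVignerasWaldspurger1987] C. Mœglin, M.-F. Vignéras, J.-L. Waldspurger, LNM 1291 (1987), Chap. 1 I.17–I.19.
* [BorelJacquet1979] A. Borel, H. Jacquet, PSPM 33.1 (1979), §4.1 (archimedean components of adelic groups).
* [Kudla1994] S. S. Kudla, Israel J. Math. 87 (1994), §3.
-/

set_option autoImplicit false

noncomputable section

open scoped ComplexConjugate
open NumberField NumberField.InfinitePlace NumberField.mixedEmbedding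
open Literature.RepresentationTheory.HeisenbergGroup

namespace Literature.NumberTheory.Automorphic

namespace UnitaryGroup

variable (F E : Type) [Field F] [Field E] [NumberField E] [Algebra F E] (c : E ≃ₐ[F] E) (N : ℕ)
  (J : Matrix (Fin N) (Fin N) E)

/-! ## §1 The pair `(w, c w)` of complex places and the untwisted two-coordinate evaluation -/

/-- the PARTNER `c • w` of a complex place `w` (complex: `isComplex_smul_iff`). [cite: PlatonovRapinchuk1994, §3.2] -/
def cPlaceC (w : {w : InfinitePlace E // IsComplex w}) : {w : InfinitePlace E // IsComplex w} :=
  ⟨c • w.1, isComplex_smul_iff.mpr w.2⟩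

omit [NumberField E] in
/-- unfolding. [cite: PlatonovRapinchuk1994, §3.2] -/
@[simp] theorem coe_cPlaceC (w : {w : InfinitePlace E // IsComplex w}) : (cPlaceC F E c w).1 = c • w.1 := rfl

omit [NumberField E] in
/-- for an involution, `c • (c • w) = w`. [cite: PlatonovRapinchuk1994, §3.2] -/
theorem smul_smul_of_mul_self (hcc : c * c = 1) (w : InfinitePlace E) : c • (c • w) = w := by
  rw [smul_smul, hcc, one_smul]

omit [NumberField E] in
/-- for an involution, the partner of the partner is the place: `cPlaceC (cPlaceC w) = w`. [cite: PlatonovRapinchuk1994, §3.2] -/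
@[simp] theorem cPlaceC_cPlaceC (hcc : c * c = 1) (w : {w : InfinitePlace E // IsComplex w}) :
    cPlaceC F E c (cPlaceC F E c w) = w :=
  Subtype.ext (smul_smul_of_mul_self F E c hcc w.1)

omit [NumberField E] in
/-- for an involution, `c (c x) = x`. [cite: PlatonovRapinchuk1994, §2.3] -/
theorem apply_apply_of_mul_self (hcc : c * c = 1) (x : E) : c (c x) = x := by
  rw [← AlgEquiv.mul_apply, hcc, AlgEquiv.one_apply]

omit [NumberField E] in
/-- `((c ⊗ 1) x)_{cw} = ψ_w (x_w)`. [cite: PlatonovRapinchuk1994, §2.3] -/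
theorem conjMixed_snd_cPlaceC (x : mixedSpace E) (w : {w : InfinitePlace E // IsComplex w}) :
    (conjMixed F E c x).2 (cPlaceC F E c w) = conjCoord F E c w (x.2 w) :=
  conjMixed_snd_smul F E c x w

omit [NumberField E] in
/-- `((c ⊗ 1) x)_w = ψ_{cw} (x_{cw})` for an involution `c`. [cite: PlatonovRapinchuk1994, §2.3] -/
theorem conjMixed_snd_eq (hcc : c * c = 1) (x : mixedSpace E) (w : {w : InfinitePlace E // IsComplex w}) :
    (conjMixed F E c x).2 w = conjCoord F E c (cPlaceC F E c w) (x.2 (cPlaceC F E c w)) := by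
  have h := conjMixed_snd_smul F E c x (cPlaceC F E c w)
  have hw : (⟨c • (cPlaceC F E c w).1, isComplex_smul_iff.mpr (cPlaceC F E c w).2⟩ :
      {w : InfinitePlace E // IsComplex w}) = w := Subtype.ext (smul_smul_of_mul_self F E c hcc w.1)
  rw [hw] at h
  exact h

omit [NumberField E] in
/-- `ψ_{cw} (ψ_w (σ_w x)) = σ_w x` on `E`. [cite: PlatonovRapinchuk1994, §2.3] -/
theorem conjCoord_cPlaceC_conjCoord_embedding (hcc : c * c = 1) (w : {w : InfinitePlace E // IsComplex w}) (x : E) :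
    conjCoord F E c (cPlaceC F E c w) (conjCoord F E c w (w.1.embedding x)) = w.1.embedding x := by
  rw [conjCoord_embedding, ← coe_cPlaceC F E c w, conjCoord_embedding, coe_cPlaceC, smul_smul_of_mul_self F E c hcc,
    apply_apply_of_mul_self F E c hcc]

omit [NumberField E] in
/-- **`ψ_{cw} ∘ ψ_w = id`**: the composite is a continuous ring endomorphism of `ℂ` fixing `σ_w(E)` pointwise; were it
complex conjugation, `σ_w` would be a real embedding — but `w` is complex. [cite: PlatonovRapinchuk1994, §2.3] -/
theorem conjCoord_cPlaceC_conjCoord (hcc : c * c = 1) (w : {w : InfinitePlace E // IsComplex w}) (z : ℂ) :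
    conjCoord F E c (cPlaceC F E c w) (conjCoord F E c w z) = z := by
  have hcont : Continuous ((conjCoord F E c (cPlaceC F E c w)).comp (conjCoord F E c w)) :=
    (continuous_conjCoord F E c (cPlaceC F E c w)).comp (continuous_conjCoord F E c w)
  rcases Complex.ringHom_eq_id_or_conj_of_continuous hcont with h | h
  · exact DFunLike.congr_fun h z
  · exfalso
    have hreal : ComplexEmbedding.IsReal w.1.embedding := by
      rw [ComplexEmbedding.isReal_iff]
      ext x
      have h1 := DFunLike.congr_fun h (w.1.embedding x)
      rw [RingHom.comp_apply, conjCoord_cPlaceC_conjCoord_embedding F E c hcc w x] at h1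
      rw [ComplexEmbedding.conjugate_coe_eq]
      exact h1.symm
    exact (isComplex_iff.mp w.2) hreal

/-- **`evalCC w : E ⊗ ℝ →+* ℂ × ℂ`**, `x ↦ (x_w, ψ_{cw}(x_{cw}))` — the projection onto `E ⊗_F F_v = E_w × E_{cw}`,
the second factor read through `ψ_{cw}` so that the conjugation becomes the plain swap.
[cite: PlatonovRapinchuk1994, §3.2] -/
def evalCC (w : {w : InfinitePlace E // IsComplex w}) : mixedSpace E →+* ℂ × ℂ :=
  (evalC E w).prod ((conjCoord F E c (cPlaceC F E c w)).comp (evalC E (cPlaceC F E c w)))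

omit [NumberField E] in
/-- unfolding. [cite: PlatonovRapinchuk1994, §3.2] -/
@[simp] theorem evalCC_apply (w : {w : InfinitePlace E // IsComplex w}) (x : mixedSpace E) :
    evalCC F E c w x = (x.2 w, conjCoord F E c (cPlaceC F E c w) (x.2 (cPlaceC F E c w))) := rfl

omit [NumberField E] in
/-- `evalCC` is continuous. [cite: PlatonovRapinchuk1994, §3.2] -/
theorem continuous_evalCC (w : {w : InfinitePlace E // IsComplex w}) : Continuous (evalCC F E c w) :=
  Continuous.prodMk ((continuous_apply w).comp continuous_snd)
    ((continuous_conjCoord F E c _).comp ((continuous_apply _).comp continuous_snd))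

omit [NumberField E] in
/-- **`evalCC ((c ⊗ 1) x) = swap (evalCC x)`**: at the pair `(w, cw)` the conjugation `c ⊗ 1` IS the swap of the two
complex factors. [cite: PlatonovRapinchuk1994, §3.2; MoeglinVignerasWaldspurger1987, Chap. 1 I.17] -/
theorem evalCC_conjMixed (hcc : c * c = 1) (w : {w : InfinitePlace E // IsComplex w}) (x : mixedSpace E) :
    evalCC F E c w (conjMixed F E c x) = (RingEquiv.prodComm : ℂ × ℂ ≃+* ℂ × ℂ).toRingHom (evalCC F E c w x) := by
  refine Prod.ext ?_ ?_
  · exact conjMixed_snd_eq F E c hcc x w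
  · show conjCoord F E c (cPlaceC F E c w) ((conjMixed F E c x).2 (cPlaceC F E c w)) = x.2 w
    rw [conjMixed_snd_cPlaceC, conjCoord_cPlaceC_conjCoord F E c hcc]

/-! ## §2 The `(w, cw)`-component of `U(J)(E ⊗ ℝ)` -/

omit [NumberField E] in
/-- the `(w, cw)`-coordinates of `J ⊗ 1`. [cite: BorelJacquet1979, §4.1] -/
theorem archFormOf_map_evalCC (w : {w : InfinitePlace E // IsComplex w}) :
    (archFormOf E N J).map (evalCC F E c w) = J.map ((evalCC F E c w).comp (mixedEmbedding E)) := by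
  rw [archFormOf, Matrix.map_map]
  rfl

/-- **`archAtComplexPair w : U(J)(E ⊗ ℝ) →* U(swap, J_{w,cw})(ℂ × ℂ)`**, the `(w, cw)`-component of an archimedean
unitary matrix (restriction of `GL_N(evalCC w)`; membership along `evalCC_conjMixed`).
[cite: BorelJacquet1979, §4.1; PlatonovRapinchuk1994, §3.2] -/
def archAtComplexPair (hcc : c * c = 1) (w : {w : InfinitePlace E // IsComplex w}) :
    arch F E c N J →*
      unitaryGroupOfForm (RingEquiv.prodComm : ℂ × ℂ ≃+* ℂ × ℂ).toRingHom (J.map ((evalCC F E c w).comp (mixedEmbedding E))) :=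
  ((Matrix.GeneralLinearGroup.map (evalCC F E c w)).restrict (arch F E c N J)).codRestrict _ fun g => by
    have h := map_mem_unitaryGroupOfForm (σ := conjMixed F E c)
      (τ := (RingEquiv.prodComm : ℂ × ℂ ≃+* ℂ × ℂ).toRingHom) (evalCC F E c w) (evalCC_conjMixed F E c hcc w) g.2
    rw [archFormOf_map_evalCC] at h
    exact h

omit [NumberField E] in
/-- underlying invertible matrix. [cite: BorelJacquet1979, §4.1] -/
@[simp] theorem coe_archAtComplexPair (hcc : c * c = 1) (w : {w : InfinitePlace E // IsComplex w}) (g : arch F E c N J) :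
    ((archAtComplexPair F E c N J hcc w g : unitaryGroupOfForm _ _) : GL (Fin N) (ℂ × ℂ)) =
      Matrix.GeneralLinearGroup.map (evalCC F E c w) (g : GL (Fin N) (mixedSpace E)) := rfl

omit [NumberField E] in
/-- entries: `(archAtComplexPair w g)ᵢⱼ = ((gᵢⱼ)_w, ψ_{cw}((gᵢⱼ)_{cw}))`. [cite: BorelJacquet1979, §4.1] -/
theorem coe_archAtComplexPair_apply (hcc : c * c = 1) (w : {w : InfinitePlace E // IsComplex w}) (g : arch F E c N J)
    (i j : Fin N) :
    (((archAtComplexPair F E c N J hcc w g : unitaryGroupOfForm _ _) : GL (Fin N) (ℂ × ℂ)) : Matrix (Fin N) (Fin N) (ℂ × ℂ))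
        i j =
      ((((g : GL (Fin N) (mixedSpace E)) : Matrix (Fin N) (Fin N) (mixedSpace E)) i j).2 w,
        conjCoord F E c (cPlaceC F E c w)
          ((((g : GL (Fin N) (mixedSpace E)) : Matrix (Fin N) (Fin N) (mixedSpace E)) i j).2 (cPlaceC F E c w))) := rfl

omit [NumberField E] in
/-- `archAtComplexPair w` is continuous. [cite: BorelJacquet1979, §4.1] -/
theorem continuous_archAtComplexPair (hcc : c * c = 1) (w : {w : InfinitePlace E // IsComplex w}) :
    Continuous (archAtComplexPair F E c N J hcc w) :=
  (((continuous_evalCC F E c w).generalLinearGroup_map :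
      Continuous (Matrix.GeneralLinearGroup.map (n := Fin N) (evalCC F E c w))).comp continuous_subtype_val).subtype_mk _

/-! ### The Gram matrix of the factor for `J = T ⊗_F E` -/

section Rational

/-- the complex embedding of `F` under the place `w` of `E`: `σ_v = σ_w|_F`. [cite: PlatonovRapinchuk1994, §2.3] -/
def cxEmbOfPlace (w : {w : InfinitePlace E // IsComplex w}) : F →+* ℂ := w.1.embedding.comp (algebraMap F E)

omit [NumberField E] in
/-- **`evalCC (x ⊗ 1) = (σ_w x, σ_w (c x))`** — no coordinate twist survives. [cite: PlatonovRapinchuk1994, §3.2] -/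
theorem evalCC_mixedEmbedding (hcc : c * c = 1) (w : {w : InfinitePlace E // IsComplex w}) (x : E) :
    evalCC F E c w (mixedEmbedding E x) = (w.1.embedding x, w.1.embedding (c x)) := by
  rw [evalCC_apply, mixedEmbedding_apply_isComplex, mixedEmbedding_apply_isComplex]
  refine Prod.ext rfl ?_
  show conjCoord F E c (cPlaceC F E c w) ((cPlaceC F E c w).1.embedding x) = w.1.embedding (c x)
  rw [conjCoord_embedding, coe_cPlaceC, smul_smul_of_mul_self F E c hcc]

omit [NumberField E] in
/-- on `F`: `evalCC (t ⊗ 1) = (σ_v t, σ_v t)`, the diagonal. [cite: PlatonovRapinchuk1994, §3.2] -/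
theorem evalCC_mixedEmbedding_algebraMap (hcc : c * c = 1) (w : {w : InfinitePlace E // IsComplex w}) (t : F) :
    evalCC F E c w (mixedEmbedding E (algebraMap F E t)) =
      ((RingHom.id ℂ).prod (RingHom.id ℂ)) (cxEmbOfPlace F E w t) := by
  rw [evalCC_mixedEmbedding F E c hcc, AlgEquiv.commutes]
  rfl

omit [NumberField E] in
/-- on an anti-invariant `δ` (`c δ = -δ`): `evalCC (δ ⊗ 1) = (s, -s)`, `s = σ_w(δ)`. [cite: PlatonovRapinchuk1994, §2.3] -/
theorem evalCC_mixedEmbedding_delta (hcc : c * c = 1) (w : {w : InfinitePlace E // IsComplex w}) {δ : E} (hcδ : c δ = -δ) :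
    evalCC F E c w (mixedEmbedding E δ) = (w.1.embedding δ, -w.1.embedding δ) := by
  rw [evalCC_mixedEmbedding F E c hcc, hcδ, map_neg]

omit [NumberField E] in
/-- **the Gram matrix of the `(w, cw)`-factor for `J = T ⊗_F E` is `σ_v(T) ⊗ 1`**.
[cite: PlatonovRapinchuk1994, §3.2; BorelJacquet1979, §4.1] -/
theorem map_evalCC_mixedEmbedding_of_map (hcc : c * c = 1) (w : {w : InfinitePlace E // IsComplex w})
    (T : Matrix (Fin N) (Fin N) F) :
    (T.map (algebraMap F E)).map ((evalCC F E c w).comp (mixedEmbedding E)) =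
      (T.map (cxEmbOfPlace F E w)).map ((RingHom.id ℂ).prod (RingHom.id ℂ)) := by
  ext i j : 1
  simp only [Matrix.map_apply]
  exact evalCC_mixedEmbedding_algebraMap F E c hcc w (T i j)

/-- **`archAtComplexSplit w : U(T ⊗ E)(E ⊗ ℝ) →* U(swap, σ_v(T) ⊗ 1)(ℂ × ℂ)`** — the `(w, cw)`-component for a form
defined over `F`, in the currency of `UnitaryGroupSymplecticSplitLevi` (`S = ℂ × ℂ`, `R = ℂ`, `φ = (id, id)`,
`σ = swap`). [cite: BorelJacquet1979, §4.1] -/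
def archAtComplexSplit (hcc : c * c = 1) (w : {w : InfinitePlace E // IsComplex w}) (T : Matrix (Fin N) (Fin N) F)
    {J : Matrix (Fin N) (Fin N) E} (hJ : J = T.map (algebraMap F E)) :
    arch F E c N J →*
      unitaryGroupOfForm (RingEquiv.prodComm : ℂ × ℂ ≃+* ℂ × ℂ).toRingHom
        ((T.map (cxEmbOfPlace F E w)).map ((RingHom.id ℂ).prod (RingHom.id ℂ))) :=
  (Subgroup.inclusion (le_of_eq (congrArg (unitaryGroupOfForm (RingEquiv.prodComm : ℂ × ℂ ≃+* ℂ × ℂ).toRingHom)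
      (by rw [hJ, map_evalCC_mixedEmbedding_of_map F E c N hcc])))).comp
    (archAtComplexPair F E c N J hcc w)

omit [NumberField E] in
/-- underlying invertible matrix. [cite: BorelJacquet1979, §4.1] -/
@[simp] theorem coe_archAtComplexSplit (hcc : c * c = 1) (w : {w : InfinitePlace E // IsComplex w})
    (T : Matrix (Fin N) (Fin N) F) {J : Matrix (Fin N) (Fin N) E} (hJ : J = T.map (algebraMap F E)) (g : arch F E c N J) :
    ((archAtComplexSplit F E c N hcc w T hJ g : unitaryGroupOfForm _ _) : GL (Fin N) (ℂ × ℂ)) =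
      Matrix.GeneralLinearGroup.map (evalCC F E c w) (g : GL (Fin N) (mixedSpace E)) := rfl

omit [NumberField E] in
/-- `archAtComplexSplit` is continuous. [cite: BorelJacquet1979, §4.1] -/
theorem continuous_archAtComplexSplit (hcc : c * c = 1) (w : {w : InfinitePlace E // IsComplex w})
    (T : Matrix (Fin N) (Fin N) F) {J : Matrix (Fin N) (Fin N) E} (hJ : J = T.map (algebraMap F E)) :
    Continuous (archAtComplexSplit F E c N hcc w T hJ) := by
  refine Continuous.subtype_mk ?_ _
  exact ((continuous_evalCC F E c w).generalLinearGroup_map :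
      Continuous (Matrix.GeneralLinearGroup.map (n := Fin N) (evalCC F E c w))).comp continuous_subtype_val

omit [NumberField E] in
/-- `σ_w(δ) ≠ 0` for `δ ≠ 0`. [cite: PlatonovRapinchuk1994, §2.3] -/
theorem embedding_ne_zero (w : {w : InfinitePlace E // IsComplex w}) {δ : E} (hδ : δ ≠ 0) : w.1.embedding δ ≠ 0 :=
  (map_ne_zero_iff _ w.1.embedding.injective).mpr hδ

end Rational

/-! ## §3 The split quadratic coordinates of `K × K` over a field `K` -/

section SplitPair

variable {K : Type*} [Field K] [CharZero K] (s : K) (hs : s ≠ 0)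

/-- the quadratic coordinates of the split algebra `K × K`: `(a, b) ↦ a·1 + b·(s, -s) = (a + b s, a - b s)`, with
inverse `(u, u') ↦ ((u + u')/2, (u - u')/(2s))`. [cite: MoeglinVignerasWaldspurger1987, Chap. 1 I.17] -/
def splitPairCoords : (K × K) ≃+ (K × K) where
  toFun p := (p.1 + p.2 * s, p.1 - p.2 * s)
  invFun q := ((q.1 + q.2) / 2, (q.1 - q.2) / (2 * s))
  left_inv p := by
    ext
    · show (p.1 + p.2 * s + (p.1 - p.2 * s)) / 2 = p.1
      ring
    · show (p.1 + p.2 * s - (p.1 - p.2 * s)) / (2 * s) = p.2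
      field_simp
      ring
  right_inv q := by
    ext
    · show (q.1 + q.2) / 2 + (q.1 - q.2) / (2 * s) * s = q.1
      field_simp
      ring
    · show (q.1 + q.2) / 2 - (q.1 - q.2) / (2 * s) * s = q.2
      field_simp
      ring
  map_add' p q := by
    ext
    · show (p.1 + q.1) + (p.2 + q.2) * s = (p.1 + p.2 * s) + (q.1 + q.2 * s)
      ring
    · show (p.1 + q.1) - (p.2 + q.2) * s = (p.1 - p.2 * s) + (q.1 - q.2 * s)
      ring

/-- formula. [cite: MoeglinVignerasWaldspurger1987, Chap. 1 I.17] -/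
@[simp] theorem splitPairCoords_apply (p : K × K) : splitPairCoords s hs p = (p.1 + p.2 * s, p.1 - p.2 * s) := rfl

/-- **`K × K` is a quadratic `K`-algebra in the coordinates `1 = (1, 1)`, `δ = (s, -s)`, `δ² = s²`.**
[cite: MoeglinVignerasWaldspurger1987, Chap. 1 I.17] -/
theorem isQuadraticCoordinates_splitPair :
    IsQuadraticCoordinates ((RingHom.id K).prod (RingHom.id K)) (splitPairCoords s hs) ((s, -s) : K × K) (s * s) where
  apply a b := by
    ext
    · show a + b * s = a + b * s
      rfl
    · show a - b * s = a + b * (-s)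
      ring
  mul_self := by
    ext
    · rfl
    · show -s * -s = s * s
      ring

omit [CharZero K] hs in
/-- the swap fixes the diagonal `K·1`. [cite: MoeglinVignerasWaldspurger1987, Chap. 1 I.17] -/
theorem swap_pair_diag (a : K) :
    (RingEquiv.prodComm : K × K ≃+* K × K).toRingHom (((RingHom.id K).prod (RingHom.id K)) a) =
      ((RingHom.id K).prod (RingHom.id K)) a := rfl

omit [CharZero K] hs in
/-- the swap negates `δ = (s, -s)` (it IS the conjugation `c ⊗ 1`). [cite: MoeglinVignerasWaldspurger1987, Chap. 1 I.17] -/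
theorem swap_pair_delta : (RingEquiv.prodComm : K × K ≃+* K × K).toRingHom ((s, -s) : K × K) = -((s, -s) : K × K) := by
  ext
  · rfl
  · show s = - -s
    rw [neg_neg]

/-- `evalPlus` of the split coordinates is the first projection. [cite: MoeglinVignerasWaldspurger1987, Chap. 1 I.17] -/
theorem evalPlus_splitPair (z : K × K) : (isQuadraticCoordinates_splitPair s hs).evalPlus rfl z = z.1 := by
  rw [IsQuadraticCoordinates.evalPlus_apply, QuadraticCoordinates.re_def, QuadraticCoordinates.im_def]
  show (z.1 + z.2) / 2 + s * ((z.1 - z.2) / (2 * s)) = z.1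
  field_simp
  ring

/-- `evalMinus` of the split coordinates is the second projection. [cite: MoeglinVignerasWaldspurger1987, Chap. 1 I.17] -/
theorem evalMinus_splitPair (z : K × K) : (isQuadraticCoordinates_splitPair s hs).evalMinus rfl z = z.2 := by
  rw [IsQuadraticCoordinates.evalMinus_apply, QuadraticCoordinates.re_def, QuadraticCoordinates.im_def]
  show (z.1 + z.2) / 2 - s * ((z.1 - z.2) / (2 * s)) = z.2
  field_simp
  ring

/-- hence `g₊` is the matrix of first components of `g ∈ GLₙ(K × K)`. [cite: Kudla1994, §3] -/
theorem coe_plusGL_splitPair {n : Type*} [Fintype n] [DecidableEq n] (g : GL n (K × K)) :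
    (((isQuadraticCoordinates_splitPair s hs).plusGL rfl n g : GL n K) : Matrix n n K) =
      (g : Matrix n n (K × K)).map Prod.fst := by
  ext i j
  rw [IsQuadraticCoordinates.coe_plusGL, Matrix.map_apply, Matrix.map_apply, evalPlus_splitPair]

/-- and `g₋` the matrix of second components. [cite: Kudla1994, §3] -/
theorem coe_minusGL_splitPair {n : Type*} [Fintype n] [DecidableEq n] (g : GL n (K × K)) :
    (((isQuadraticCoordinates_splitPair s hs).minusGL rfl n g : GL n K) : Matrix n n K) =
      (g : Matrix n n (K × K)).map Prod.snd := by
  ext i j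
  rw [IsQuadraticCoordinates.coe_minusGL, Matrix.map_apply, Matrix.map_apply, evalMinus_splitPair]

end SplitPair

/-! ### `g₊` of the `(w, cw)`-factor is the `w`-component `g_w ∈ GL_N(ℂ)` -/

section Plus

omit [NumberField E] in
/-- **the `g₊`-parameter of the `(w, cw)`-factor is the `w`-COMPONENT `g_w` of `g`**: entries `(gᵢⱼ)_w`, in the
split coordinates `1, δ ⊗ 1 = (σ_w δ, -σ_w δ)`. [cite: Kudla1994, §3] -/
theorem coe_plusGL_archAtComplexSplit (hcc : c * c = 1) (w : {w : InfinitePlace E // IsComplex w})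
    (T : Matrix (Fin N) (Fin N) F) {J : Matrix (Fin N) (Fin N) E} (hJ : J = T.map (algebraMap F E)) {δ : E} (hδ : δ ≠ 0)
    (g : arch F E c N J) (i j : Fin N) :
    (((isQuadraticCoordinates_splitPair (w.1.embedding δ) (embedding_ne_zero E w hδ)).plusGL rfl
        (Fin N) (archAtComplexSplit F E c N hcc w T hJ g : unitaryGroupOfForm _ _) : GL (Fin N) ℂ) : Matrix (Fin N) (Fin N) ℂ)
        i j =
      ((((g : GL (Fin N) (mixedSpace E)) : Matrix (Fin N) (Fin N) (mixedSpace E)) i j).2 w) := by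
  rw [coe_plusGL_splitPair, Matrix.map_apply, coe_archAtComplexSplit]
  rfl

omit [NumberField E] in
/-- the `g₊`-parameter as a matrix: `g₊ = g.map (x ↦ x_w)` (the `w`-component, `evalC w`). [cite: Kudla1994, §3] -/
theorem coe_plusGL_archAtComplexSplit_eq (hcc : c * c = 1) (w : {w : InfinitePlace E // IsComplex w})
    (T : Matrix (Fin N) (Fin N) F) {J : Matrix (Fin N) (Fin N) E} (hJ : J = T.map (algebraMap F E)) {δ : E} (hδ : δ ≠ 0)
    (g : arch F E c N J) :
    (((isQuadraticCoordinates_splitPair (w.1.embedding δ) (embedding_ne_zero E w hδ)).plusGL rfl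
        (Fin N) (archAtComplexSplit F E c N hcc w T hJ g : unitaryGroupOfForm _ _) : GL (Fin N) ℂ) : Matrix (Fin N) (Fin N) ℂ) =
      (((g : GL (Fin N) (mixedSpace E)) : Matrix (Fin N) (Fin N) (mixedSpace E))).map (evalC E w) :=
  Matrix.ext fun i j => coe_plusGL_archAtComplexSplit F E c N hcc w T hJ hδ g i j

end Plus

end UnitaryGroup

end Literature.NumberTheory.Automorphic

end
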